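import Literature.AlgebraicTopology.FundamentalGroup.DeformationRetractInclusion
import HarnessLib

/-!
# Seifert–van Kampen for closed pieces through deformation-retracting open neighbourhoods

Topic `Literature/AlgebraicTopology/FundamentalGroup`.  The Seifert–van Kampen theorem of the
tree (`VanKampenPushout.lean`; epimorphic form `VanKampenEpi.lean`) is stated for a cover of a
space `Y` by two OPEN sets.  In the applications — a Heegaard splitting `H ∪_F H'` of a closed
`3`-manifold, the three sectors of a trisected `4`-manifold, CW decompositions — the pieces are
CLOSED, and one passes through open neighbourhoods `U ⊇ P`, `T ⊇ Q` that deformation retract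
onto the pieces, with `U ∩ T` deformation retracting onto `F = P ∩ Q` (Hatcher, *Algebraic
Topology* (2002), §1.2, Example 1.21 ff. and the proof of Prop. 1.26: "choose open
neighborhoods `A_α` … that deformation retract onto …").  This file packages that passage once
and for all, in the epimorphic form used for handlebody decompositions:

**Theorem** (`surjective_inclHom_and_ker_eq_of_deformationRetracts`).  Let `Y = U ∪ T` with
`U`, `T` open and `U`, `T`, `U ∩ T` path connected; let `P ⊆ U`, `Q ⊆ T`, `F ⊆ P ∩ Q` with
`x₀ ∈ F`, and suppose `P` is a strong deformation retract of `U`, `Q` of `T`, and `F` of `U ∩ T`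
(`Literature.AlgebraicTopology.Homotopy.IsStrongDeformationRetractOf`).  If the maps
`π₁(F, x₀) → π₁(P, x₀)` and `π₁(F, x₀) → π₁(Q, x₀)` induced by the inclusions are surjective,
then `π₁(F, x₀) → π₁(Y, x₀)` is surjective and its kernel is the normal closure of
`ker (π₁ F → π₁ P) ∪ ker (π₁ F → π₁ Q)`.

So `π₁(Y) ≅ π₁(F) ⧸ ⟪ker ∪ ker⟫` is computed from the closed pieces alone; the open
neighbourhoods enter only through their existence (for manifold pieces: collars,
`Literature/AlgebraicTopology/Homotopy/StrongDeformationRetractUnion.lean` with the collar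
theorem).  Proof: by Hatcher's Prop. 1.17 (`DeformationRetractInclusion.lean`) the maps
`π₁ P → π₁ U`, `π₁ Q → π₁ T`, `π₁ F → π₁(U ∩ T)` are bijective, so `π₁ F → π₁ U` is onto with
the kernel of `π₁ F → π₁ P` (and likewise for `T`), every loop in `U ∩ T` at `x₀` comes from
`π₁ F`, and the epimorphic van Kampen theorem (`surjective_and_ker_eq_normalClosure_of_epi`)
applies with edge group `Λ = π₁(F, x₀)`.

Also: `inclHomOfSubset_comp` (functoriality of the maps induced by nested inclusions) and
`IsStrongDeformationRetractOf.isPathConnected` (a set deformation retracting onto a path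
connected subset is path connected), used to discharge the hypotheses in applications.

## References

* A. Hatcher, *Algebraic Topology*, CUP (2002), §1.2: Thm. 1.20, Example 1.21 ff. (open
  neighbourhoods deformation retracting onto closed pieces), Prop. 1.17. [HatcherAT2002]
-/

noncomputable section

open Set
open scoped unitInterval

/-! ### A deformation retract onto a path connected set is path connected -/

namespace Literature.AlgebraicTopology.Homotopy

namespace IsStrongDeformationRetractOf

variable {X : Type*} [TopologicalSpace X] {A S : Set X}

/-- If `A` is a strong deformation retract of `S` and `A ∩ S` is path connected, then `S` is
path connected: every `x ∈ S` is joined inside `S` to `H₁ x ∈ A ∩ S` by `t ↦ H_t x`.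
[folklore] -/
theorem isPathConnected (h : IsStrongDeformationRetractOf A S) (hA : IsPathConnected (A ∩ S)) :
    IsPathConnected S := by
  obtain ⟨H, h0, h1, -⟩ := h
  obtain ⟨a, ⟨-, haS⟩, hjoin⟩ := hA
  refine ⟨a, haS, fun y hy => ?_⟩
  -- the track of `y` under the deformation, a path in `S` from `y` to `H₁ y`
  let γ : Path y (H (1, ⟨y, hy⟩) : X) :=
    { toFun := fun t => (H (t, ⟨y, hy⟩) : X)
      continuous_toFun :=
        continuous_subtype_val.comp (H.continuous.comp (continuous_id.prodMk continuous_const))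
      source' := by
        show (H (0, ⟨y, hy⟩) : X) = y
        rw [h0]
      target' := rfl }
  have hy1 : JoinedIn S (H (1, ⟨y, hy⟩) : X) y := ⟨γ.symm, fun t => (H (_, ⟨y, hy⟩)).2⟩
  exact ((hjoin ⟨h1 ⟨y, hy⟩, (H (1, ⟨y, hy⟩)).2⟩).mono inter_subset_right).trans hy1

end IsStrongDeformationRetractOf

end Literature.AlgebraicTopology.Homotopy

namespace Literature.AlgebraicTopology.FundamentalGroup

namespace VanKampen

variable {Y : Type*} [TopologicalSpace Y]

/-! ### Functoriality of the maps induced by nested inclusions -/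

/-- Functoriality: `π₁(S) → π₁(S') → π₁(S'')` is `π₁(S) → π₁(S'')` for `S ⊆ S' ⊆ S''`.
[folklore] -/
theorem inclHomOfSubset_comp {S S' S'' : Set Y} {x₀ : Y} (h : S ⊆ S') (h' : S' ⊆ S'')
    (hx : x₀ ∈ S) (hx' : x₀ ∈ S') (hx'' : x₀ ∈ S'') :
    (inclHomOfSubset h' x₀ hx' hx'').comp (inclHomOfSubset h x₀ hx hx') =
      inclHomOfSubset (h.trans h') x₀ hx hx'' := by
  ext a
  induction a using PushoutData.ind_fromPath with
  | h δ =>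
    rw [MonoidHom.comp_apply]
    simp only [inclHomOfSubset, _root_.FundamentalGroup.mapOfEq_apply]
    rfl

/-- Pointwise functoriality of `inclHomOfSubset`. [folklore] -/
theorem inclHomOfSubset_inclHomOfSubset {S S' S'' : Set Y} {x₀ : Y} (h : S ⊆ S') (h' : S' ⊆ S'')
    (hx : x₀ ∈ S) (hx' : x₀ ∈ S') (hx'' : x₀ ∈ S'') (a : _root_.FundamentalGroup S ⟨x₀, hx⟩) :
    inclHomOfSubset h' x₀ hx' hx'' (inclHomOfSubset h x₀ hx hx' a) =
      inclHomOfSubset (h.trans h') x₀ hx hx'' a :=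
  DFunLike.congr_fun (inclHomOfSubset_comp h h' hx hx' hx'') a

/-! ### The theorem -/

section ClosedPieces

variable {U T P Q F : Set Y} {x₀ : Y}

/-- **Seifert–van Kampen for closed pieces, through deformation-retracting open
neighbourhoods (epimorphic form).**  Let `Y = U ∪ T` with `U`, `T` open and `U`, `T`, `U ∩ T`
path connected; let `P ⊆ U`, `Q ⊆ T`, `F ⊆ P ∩ Q`, `x₀ ∈ F`, with `P` a strong deformation
retract of `U`, `Q` of `T`, and `F` of `U ∩ T`.  If `π₁(F, x₀) → π₁(P, x₀)` and
`π₁(F, x₀) → π₁(Q, x₀)` (induced by the inclusions) are surjective, then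
`π₁(F, x₀) → π₁(Y, x₀)` is surjective with kernel the normal closure of
`ker (π₁ F → π₁ P) ∪ ker (π₁ F → π₁ Q)` — i.e. `π₁(Y) ≅ π₁(F) ⧸ ⟪ker ∪ ker⟫`, computed from the
closed pieces (Hatcher, Thm. 1.20 with Lemma 1.15, applied as in §1.2 to open neighbourhoods
deformation retracting onto the pieces, Prop. 1.17). [cite: HatcherAT2002, Thm. 1.20] -/
theorem surjective_inclHom_and_ker_eq_of_deformationRetracts (hUo : IsOpen U) (hTo : IsOpen T)
    (hcov : U ∪ T = univ) (hUpc : IsPathConnected U) (hTpc : IsPathConnected T)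
    (hmeet : IsPathConnected (U ∩ T)) (hPU : P ⊆ U) (hQT : Q ⊆ T) (hFP : F ⊆ P) (hFQ : F ⊆ Q)
    (hxF : x₀ ∈ F) (hP : Homotopy.IsStrongDeformationRetractOf P U)
    (hQ : Homotopy.IsStrongDeformationRetractOf Q T)
    (hF : Homotopy.IsStrongDeformationRetractOf F (U ∩ T))
    (hsP : Function.Surjective (inclHomOfSubset hFP x₀ hxF (hFP hxF)))
    (hsQ : Function.Surjective (inclHomOfSubset hFQ x₀ hxF (hFQ hxF))) :
    Function.Surjective (inclHom F x₀ hxF) ∧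
      (inclHom F x₀ hxF).ker = Subgroup.normalClosure
        (((inclHomOfSubset hFP x₀ hxF (hFP hxF)).ker : Set _) ∪
          (inclHomOfSubset hFQ x₀ hxF (hFQ hxF)).ker) := by
  have hxP : x₀ ∈ P := hFP hxF
  have hxQ : x₀ ∈ Q := hFQ hxF
  have hxU : x₀ ∈ U := hPU hxP
  have hxT : x₀ ∈ T := hQT hxQ
  have hFUT : F ⊆ U ∩ T := fun y hy => ⟨hPU (hFP hy), hQT (hFQ hy)⟩
  -- Prop. 1.17 for the three deformation retracts
  have hbP := bijective_inclHomOfSubset_of_isStrongDeformationRetractOf hP hPU hxP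
  have hbQ := bijective_inclHomOfSubset_of_isStrongDeformationRetractOf hQ hQT hxQ
  have hbF := bijective_inclHomOfSubset_of_isStrongDeformationRetractOf hF hFUT hxF
  -- the edge maps `π₁ F → π₁ U`, `π₁ F → π₁ T`
  set jU := inclHomOfSubset (hFP.trans hPU) x₀ hxF hxU with hjU
  set jT := inclHomOfSubset (hFQ.trans hQT) x₀ hxF hxT with hjT
  have hjU' : jU = (inclHomOfSubset hPU x₀ hxP hxU).comp (inclHomOfSubset hFP x₀ hxF hxP) :=
    (inclHomOfSubset_comp hFP hPU hxF hxP hxU).symm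
  have hjT' : jT = (inclHomOfSubset hQT x₀ hxQ hxT).comp (inclHomOfSubset hFQ x₀ hxF hxQ) :=
    (inclHomOfSubset_comp hFQ hQT hxF hxQ hxT).symm
  have hsU : Function.Surjective jU := by
    rw [hjU']
    exact hbP.2.comp hsP
  have hsT : Function.Surjective jT := by
    rw [hjT']
    exact hbQ.2.comp hsQ
  have hkU : jU.ker = (inclHomOfSubset hFP x₀ hxF hxP).ker := by
    rw [hjU']
    exact MonoidHom.ker_comp_of_injective _ _ hbP.1
  have hkT : jT.ker = (inclHomOfSubset hFQ x₀ hxF hxQ).ker := by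
    rw [hjT']
    exact MonoidHom.ker_comp_of_injective _ _ hbQ.1
  have hcomm : (inclHom U x₀ hxU).comp jU = (inclHom T x₀ hxT).comp jT := by
    rw [hjU, hjT, inclHom_comp_inclHomOfSubset, inclHom_comp_inclHomOfSubset]
  -- every loop in `U ∩ T` at `x₀` comes from `π₁ F`
  have hlift : ∀ (δ : Path x₀ x₀) (hU : ∀ t, δ t ∈ U) (hT : ∀ t, δ t ∈ T), ∃ l,
      jU l = _root_.FundamentalGroup.fromPath (Path.Homotopic.Quotient.mk (liftPath U δ hU)) ∧
      jT l = _root_.FundamentalGroup.fromPath (Path.Homotopic.Quotient.mk (liftPath T δ hT)) := by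
    intro δ hU hT
    obtain ⟨l, hl⟩ := hbF.2 (_root_.FundamentalGroup.fromPath
      (Path.Homotopic.Quotient.mk (liftPath (U ∩ T) δ fun t => ⟨hU t, hT t⟩)))
    refine ⟨l, ?_, ?_⟩
    · rw [hjU, ← inclHomOfSubset_comp hFUT inter_subset_left hxF ⟨hxU, hxT⟩ hxU,
        MonoidHom.comp_apply, hl, inclHomOfSubset_fromPath_liftPath]
    · rw [hjT, ← inclHomOfSubset_comp hFUT inter_subset_right hxF ⟨hxU, hxT⟩ hxT,
        MonoidHom.comp_apply, hl, inclHomOfSubset_fromPath_liftPath]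
  have h := surjective_and_ker_eq_normalClosure_of_epi hUo hTo hcov hxU hxT hUpc hTpc hmeet
    jU jT hsU hsT hcomm hlift
  rw [hjU, inclHom_comp_inclHomOfSubset, ← hjU, hkU, hkT] at h
  exact h

end ClosedPieces

end VanKampen

end Literature.AlgebraicTopology.FundamentalGroup

end
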